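import Summits.QuantumFields.BalabanUV.Beta.D1BFx.TorusWeightJetsTwisted

/-!
# `BalabanUV.Beta.D1BFx.TorusWeightJetsProjector` — road «BF-x» for binder row D1, slot (K), X₃(ii) ROUTE T, owner row **«TB4-W»** (K-ASSEMBLY-SPEC v2.5 §3 (T3);
# rulings ρ-g6-12 (1) ∕ ρ-g6-13 (1) ∕ NOTE ρ-g6-13b), PART 3b-α — **THE STRIPPED WEIGHT JETS IN PROJECTOR FORM (THE J5 JUNCTION ON THE TORUS)**: with the
# site matrices `R̂ := L̂ĈL̂` (`= 1 − P̂` for a basis of `ker Ŝ`, `TorusWeightJetsCombFree.Lhat_Chat_Lhat`) and its jets `R̂ₛ := L̂ₛĈL̂ + L̂ĈₛL̂ + L̂ĈL̂ₛ`,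
# `R̂ₛₜ` (nine-term product rule), PART 3a′'s comb-free TWISTED weight jets are
# **`twgt₁ = D̂R̂ₛD̂ᵀ + ÊₛR̂D̂ᵀ − D̂R̂Êₛᵀ`** and **`twgtMix = D̂R̂ₛₜD̂ᵀ + (ÊₛR̂ₜD̂ᵀ − D̂R̂ₜÊₛᵀ) + (ÊₜR̂ₛD̂ᵀ − D̂R̂ₛÊₜᵀ) − (ÊₛR̂Êₜᵀ + ÊₜR̂Êₛᵀ) + [bₛ = bₜ]•(ÊₛR̂D̂ᵀ + D̂R̂Êₛᵀ)`**
# — the torus images of leaf-05-g3's J5 assembly words `dSw Ṙ = d∘Ṙ∘dᵀ` and `−dJetSw κ u R = Ḋ∘R∘dᵀ − d∘R∘Ḋᵀ` (`RJetAssembly`): in the `ε = −1` convention of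
# J5 the stripped first weight jet `b̃ₛ = 2•twgt₁` IS `2•RjetOf R Ṙ` at `R :=` (the `ℤ⁴` kernel of) `L C L`, `Ṙ :=` its stripped jet

HONEST DEPENDENCY (cell records, verbatim): «continuum YM on T⁴ ⇐ BetaPertH ∧ nine spine estimates (0/9 proved); BetaPertH ⇐ (D1) ∧ (D4) ∧
CAP+tail; G-an2-4 gates asym, D1 and NE2/3/4.»  HONEST FRAMING (cell contract, verbatim): «discharging `BetaPertH` makes Bałaban's UV stability
UNCONDITIONAL — a real constructive-QFT result; it is NOT the continuum limit and NOT the Clay problem.»  THIS MODULE DISCHARGES NOTHING of (K),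
of D1 or of the wall: [our object] data definitions (explicit finite matrices, asserting nothing) and [folklore] finite matrix algebra over PART 2
`TorusCoframeJets` (`Djet`, `Ljet`, `Ljet₁₁`, `Mjet•`, `transpose_Ljet`, `transpose_Ljet₁₁`), PART 3a `TorusWeightJetsCombFree` (`Chat`, `Cjet•`, `wgt₀`,
`Lhat_Chat_Lhat`) and PART 3a′ `TorusWeightJetsTwisted` (`twgt₁`, `twgtMix`), the owner's `TorusGaugeWeight.Lhat_transpose`, BY NAME.  No `def … : Prop`,
nothing cited, no wall binder instantiated, 0 sorry.  0∕4 binders of row D1; (K) NOT closed; NOT D1, NOT BetaPertH, NOT continuum, NOT Clay.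

ABSOLUTE RULE (cell charter, verbatim): «No internally-minted statement may enter as a cited fact. Every hypothesis is either kernel-proved in this
package or a verbatim quotation of a PUBLISHED theorem with page reference. The manuscript(s) under audit are NOT citable for their own disputed
steps — they are the thing under adjudication; programme-internal (2001/route/tribunal) claims are never citable.»

WHY (K-ASSEMBLY-SPEC v1.2∕v2 §2 «`B̂ₛ` = periodised arrays of `2·(PᵀP)`-jets = J5»; v2.1 replaced the `Rjet` letters by the co-frame `(τ′, A)`; this file
shows the two bookkeepings AGREE at jet level on every torus).  The stripped jets of the weight `B(U) = 2·D_U R_U D_U*`, `R_U = L_U C_U L_U`, are by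
THE CONVENTION (`ε = +1`; `(D*)₁ = −Êᵀ`, `(D*)ₛₜ = +[bₛ=bₜ]Êᵀ`, `CᵀC = −C²` on (odd × oddᵀ) monomials): first `2(D̂R̂ₛD̂ᵀ + ÊₛR̂D̂ᵀ − D̂R̂Êₛᵀ)`, mixed as
displayed in the title; PART 3a′ computed the SAME jets from K-TA4C's twisted Gram polynomials of the co-frame jets — `twgt₁_eq_proj`, `twgtMix_eq_proj`
are the identity of the two computations (pure algebra, any `N`).  For TB5-2 this pins the `ℤ⁴` tables of the weight jets as `RJetAssembly` words
(`dSw`, `dJetSw`, `sandwich`) in the site kernels `R = L C L` (`= δ − Pker`-type, decaying, periodic — PART 3a `Chat_eq`) and their local jets — the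
currency of TA2's `arr` and of the `SortedTraces` socket.

CONTENT (`N : Matrix (Site 4 s) ρ ℝ`; `Ĉ := Chat s N`, `Ê_b := Djet s b`, `D̂ := Dhat 4 s`, `L̂ := Lhat s`):
* §1 [our object] `Proj s N := L̂ĈL̂`, `Proj₁ s b N := Ljet·Ĉ·L̂ + L̂·Ĉₛ·L̂ + L̂·Ĉ·Ljet`, `Proj₁₁ s b b′ N` (nine terms); parities `(Proj)ᵀ = Proj`, `(Proj₁)ᵀ = −Proj₁`.
* §2 [folklore] **`wgt₀_eq_proj : wgt₀ = D̂·Proj·D̂ᵀ`**, **`twgt₁_eq_proj`**, **`twgtMix_eq_proj`** (the title identities).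
* §3 for a basis `N` of `ker Ŝ`: `Proj_eq_Rhat : Proj = 1 − P̂`, hence `twgt₁ = D̂R̂ₛD̂ᵀ + Êₛ(1 − P̂)D̂ᵀ − D̂(1 − P̂)Êₛᵀ` (`twgt₁_road`).
* §4 THE GHOST CO-FRAME WORDS of NOTE ρ-g6-13b (`X(U) := T(U)Ŵ₀ = Nᵀ L_U D_U* D̂ N`, the `(τ′W)`-slot of `hessT_gram_split_jets` under (R2)): [our object]
  `Xjet₀∕Xjet₁∕Xjet₁₁ := Nᵀ·M̂•·D̂·N`; [folklore] **`Tjet•_mul_basis : Tjet• N e * (D̂.submatrix e id * N) = Xjet•`** for a bijective re-indexing `e` (road: `e₁`),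
  `Xjet₀_eq_Gjet₀ : X₀ = G₀` (`D̂ᵀD̂ = L̂`), **`Xjet₁_eq : X₁ = Nᵀ(Ljet·L̂ − L̂·(ÊᵀD̂))N`** (the owner's displayed word; NOT `G₁` — the (R2) reading).
NOT HERE: the `ℤ⁴` arrays (PART 3b-β: `Ê`, `Ljet`, `D̂ŶD̂ᵀ`, `ÊŶD̂ᵀ − D̂ŶÊᵀ` as periodised `arr`'s of `djF`, `ghCur`, `dSw`, `−dJetSw`), TB4-tables (T1), (T2-kin), TB5.
Provenance: D1 formalisation swarm, unit `b2b-balaban-beta-d1-formalise-leaf-03` (gen 9), claim «TB4-W» journal l.23490 ∕ plan l.24110, 2026-08-21.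
-/

noncomputable section

namespace Summit.QuantumFields.BalabanUV.Beta.D1BFx.TorusWeightJetsProjector

open Matrix
open scoped BigOperators
open Literature.MathematicalPhysics.QuantumFieldTheory.Balaban1983to89
open Literature.MathematicalPhysics.QuantumFieldTheory.Balaban1983to89.Beta
open Summit.QuantumFields.BalabanUV.Beta.D1BFx.PeriodisedProjector (Lhat Shat Phat)
open Summit.QuantumFields.BalabanUV.Beta.D1BFx.TorusGaugeWeight (Lhat_transpose)
open Summit.QuantumFields.BalabanUV.Beta.D1BFx.TorusHodgeWeight (Dhat Dhat_transpose_mul_Dhat)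
open Summit.QuantumFields.BalabanUV.Beta.D1BFx.TorusCoframeJets (Djet Ljet Ljet₁₁ Ljet₁₁_self Ljet₁₁_of_ne Mjet₀ Mjet₁ Mjet₁₁ Tjet₀ Tjet₁ Tjet₁₁ Gjet₀
  transpose_Ljet transpose_Ljet₁₁)
open Summit.QuantumFields.BalabanUV.Beta.D1BFx.TorusWeightJetsCombFree (Chat Cjet₁ Cjet₁₁ wgt₀ Lsq₁ Lhat_Chat_Lhat)
open Summit.QuantumFields.BalabanUV.Beta.D1BFx.TorusWeightJetsTwisted (twgt₁ twgtMix transpose_Chat transpose_Cjet₁)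

variable (s : ℕ) [NeZero s] (b b' : Site 4 s × Fin 4)

section Basis

variable {ρ : Type*} [Fintype ρ] [DecidableEq ρ] (N : Matrix (Site 4 s) ρ ℝ)

/-! ## §1 The projector `R̂ = L̂ĈL̂` and its jets -/

/-- [our object] **`R̂ := L̂·Ĉ·L̂`** (for a basis of `ker Ŝ`: `= 1 − P̂`, §3).  A definition. -/
def Proj : Matrix (Site 4 s) (Site 4 s) ℝ := Lhat s * Chat s N * Lhat s

/-- [our object] **`R̂ₛ := Ljet·Ĉ·L̂ + L̂·Ĉₛ·L̂ + L̂·Ĉ·Ljet`** (first jet of `L̂ĈL̂` by the product rule; no transposes, no twist).  A definition. -/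
def Proj₁ : Matrix (Site 4 s) (Site 4 s) ℝ := Ljet s b * Chat s N * Lhat s + Lhat s * Cjet₁ s b N * Lhat s + Lhat s * Chat s N * Ljet s b

/-- [our object] **`R̂ₛₜ`** := the nine-term mixed jet of the triple product `L̂ĈL̂`.  A definition. -/
def Proj₁₁ : Matrix (Site 4 s) (Site 4 s) ℝ :=
  Ljet₁₁ s b b' * Chat s N * Lhat s + Ljet s b * Cjet₁ s b' N * Lhat s + Ljet s b * Chat s N * Ljet s b'
    + Ljet s b' * Cjet₁ s b N * Lhat s + Lhat s * Cjet₁₁ s b b' N * Lhat s + Lhat s * Cjet₁ s b N * Ljet s b'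
    + Ljet s b' * Chat s N * Ljet s b + Lhat s * Cjet₁ s b' N * Ljet s b + Lhat s * Chat s N * Ljet₁₁ s b b'

/-- [folklore] `R̂ᵀ = R̂`. -/
theorem transpose_Proj : (Proj s N)ᵀ = Proj s N := by
  rw [Proj, Matrix.transpose_mul, Matrix.transpose_mul, transpose_Chat, Lhat_transpose, Matrix.mul_assoc]

/-- [folklore] PARITY: `R̂ₛᵀ = −R̂ₛ` (odd). -/
theorem transpose_Proj₁ : (Proj₁ s b N)ᵀ = -Proj₁ s b N := by
  have hC := transpose_Chat s N
  have h1 := transpose_Cjet₁ s b N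
  have hL := transpose_Ljet s b
  rw [Proj₁]
  simp only [Matrix.transpose_add, Matrix.transpose_mul, hC, h1, hL, Lhat_transpose, Matrix.mul_neg, Matrix.neg_mul, Matrix.mul_assoc, neg_add]
  abel

/-! ## §2 The weight jets in projector form -/

/-- [folklore] **`wgt₀ = D̂·R̂·D̂ᵀ`** (`M̂₀ = L̂D̂ᵀ`). -/
theorem wgt₀_eq_proj : wgt₀ s N = Dhat 4 s * Proj s N * (Dhat 4 s)ᵀ := by
  rw [wgt₀, Mjet₀, Proj, Matrix.transpose_mul, Matrix.transpose_transpose, Lhat_transpose]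
  simp only [Matrix.mul_assoc]

/-- [folklore] **THE FIRST STRIPPED WEIGHT JET IN PROJECTOR FORM**: `twgt₁ = D̂R̂ₛD̂ᵀ + ÊₛR̂D̂ᵀ − D̂R̂Êₛᵀ` — the torus image of J5's assembly
`dSw Ṙ − dJetSw κ u R` in THE CONVENTION `ε = +1` (`= RjetOf R Ṙ` in J5's `ε = −1`). -/
theorem twgt₁_eq_proj : twgt₁ s b N
    = Dhat 4 s * Proj₁ s b N * (Dhat 4 s)ᵀ + Djet s b * Proj s N * (Dhat 4 s)ᵀ - Dhat 4 s * Proj s N * (Djet s b)ᵀ := by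
  have hL := transpose_Ljet s b
  rw [twgt₁, Mjet₁, Mjet₀, Proj, Proj₁]
  simp only [Matrix.transpose_mul, Matrix.transpose_sub, Matrix.transpose_transpose, hL, Lhat_transpose, Matrix.mul_add, Matrix.add_mul,
    Matrix.mul_sub, Matrix.sub_mul, Matrix.mul_neg, Matrix.neg_mul, Matrix.mul_assoc, neg_sub]
  abel

/-- [folklore] **THE MIXED STRIPPED WEIGHT JET IN PROJECTOR FORM**:
`twgtMix = D̂R̂ₛₜD̂ᵀ + (ÊₛR̂ₜD̂ᵀ − D̂R̂ₜÊₛᵀ) + (ÊₜR̂ₛD̂ᵀ − D̂R̂ₛÊₜᵀ) − (ÊₛR̂Êₜᵀ + ÊₜR̂Êₛᵀ) + [bₛ = bₜ]•(ÊₛR̂D̂ᵀ + D̂R̂Êₛᵀ)`. -/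
theorem twgtMix_eq_proj : twgtMix s b b' N
    = Dhat 4 s * Proj₁₁ s b b' N * (Dhat 4 s)ᵀ
      + (Djet s b * Proj₁ s b' N * (Dhat 4 s)ᵀ - Dhat 4 s * Proj₁ s b' N * (Djet s b)ᵀ)
      + (Djet s b' * Proj₁ s b N * (Dhat 4 s)ᵀ - Dhat 4 s * Proj₁ s b N * (Djet s b')ᵀ)
      - (Djet s b * Proj s N * (Djet s b')ᵀ + Djet s b' * Proj s N * (Djet s b)ᵀ)
      + (if b = b' then Djet s b * Proj s N * (Dhat 4 s)ᵀ + Dhat 4 s * Proj s N * (Djet s b)ᵀ else 0) := by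
  have hL := transpose_Ljet s b
  have hL' := transpose_Ljet s b'
  have hL11 := transpose_Ljet₁₁ s b b'
  by_cases h : b = b'
  · subst h
    rw [if_pos rfl, twgtMix, Mjet₁₁, if_pos rfl, Mjet₁, Mjet₀, Proj, Proj₁, Proj₁₁]
    simp only [Matrix.transpose_mul, Matrix.transpose_sub, Matrix.transpose_add, Matrix.transpose_transpose, hL, hL11, Lhat_transpose,
      Matrix.mul_add, Matrix.add_mul, Matrix.mul_sub, Matrix.sub_mul, Matrix.mul_neg, Matrix.neg_mul, Matrix.mul_assoc, neg_sub]
    abel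
  · rw [if_neg h, twgtMix, Mjet₁₁, if_neg h, Mjet₁, Mjet₁, Mjet₀, Proj, Proj₁, Proj₁, Proj₁₁, add_zero, add_zero]
    simp only [Matrix.transpose_mul, Matrix.transpose_sub, Matrix.transpose_add, Matrix.transpose_transpose, hL, hL', hL11, Lhat_transpose,
      Matrix.mul_add, Matrix.add_mul, Matrix.mul_sub, Matrix.sub_mul, Matrix.mul_neg, Matrix.neg_mul, Matrix.mul_assoc, neg_sub]
    abel

/-! ## §3 For a basis of `ker Ŝ`: `R̂ = 1 − P̂` -/

variable (m : ℕ) {a : ℝ} (p : ℕ) [NeZero p]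

/-- [folklore] **`R̂ = 1 − P̂`** for a basis `N` of `ker Ŝ` (PART 3a `Lhat_Chat_Lhat`). -/
theorem Proj_eq_Rhat (ha : 0 < a) {N : Matrix (Site 4 ((m + 1) * p)) ρ ℝ}
    (hN : ∀ lam : Site 4 ((m + 1) * p) → ℝ, Shat m ((m + 1) * p) *ᵥ lam = 0 ↔ ∃ c : ρ → ℝ, lam = N *ᵥ c)
    (hNinj : Function.Injective N.mulVec) : Proj ((m + 1) * p) N = 1 - Phat m a ((m + 1) * p) :=
  Lhat_Chat_Lhat m p ha hN hNinj

/-- [folklore] **THE FIRST STRIPPED WEIGHT JET ON THE ROAD**: `twgt₁ = D̂R̂ₛD̂ᵀ + Êₛ(1 − P̂)D̂ᵀ − D̂(1 − P̂)Êₛᵀ` for a basis `N` of `ker Ŝ`. -/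
theorem twgt₁_road (ha : 0 < a) {N : Matrix (Site 4 ((m + 1) * p)) ρ ℝ}
    (hN : ∀ lam : Site 4 ((m + 1) * p) → ℝ, Shat m ((m + 1) * p) *ᵥ lam = 0 ↔ ∃ c : ρ → ℝ, lam = N *ᵥ c)
    (hNinj : Function.Injective N.mulVec) (c : Site 4 ((m + 1) * p) × Fin 4) :
    twgt₁ ((m + 1) * p) c N
      = Dhat 4 ((m + 1) * p) * Proj₁ ((m + 1) * p) c N * (Dhat 4 ((m + 1) * p))ᵀ
        + Djet ((m + 1) * p) c * (1 - Phat m a ((m + 1) * p)) * (Dhat 4 ((m + 1) * p))ᵀ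
        - Dhat 4 ((m + 1) * p) * (1 - Phat m a ((m + 1) * p)) * (Djet ((m + 1) * p) c)ᵀ := by
  rw [twgt₁_eq_proj, Proj_eq_Rhat m p ha hN hNinj]

/-! ## §4 The ghost co-frame words `X• = T•·Ŵ₀ = Nᵀ·M̂•·D̂·N` (NOTE ρ-g6-13b) -/

/-- [our object] **`X₀ := Nᵀ·M̂₀·D̂·N`** (`= NᵀL̂D̂ᵀD̂N = G₀`).  A definition. -/
def Xjet₀ : Matrix ρ ρ ℝ := Nᵀ * Mjet₀ s * Dhat 4 s * N

/-- [our object] **`Xₛ := Nᵀ·M̂ₛ·D̂·N`**.  A definition. -/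
def Xjet₁ : Matrix ρ ρ ℝ := Nᵀ * Mjet₁ s b * Dhat 4 s * N

/-- [our object] **`Xₛₜ := Nᵀ·M̂ₛₜ·D̂·N`**.  A definition. -/
def Xjet₁₁ : Matrix ρ ρ ℝ := Nᵀ * Mjet₁₁ s b b' * Dhat 4 s * N

omit [Fintype ρ] [DecidableEq ρ] in
/-- [folklore] Re-indexed co-frame × re-indexed basis: `((NᵀM)|ₑ)·((D̂|ₑ)·N) = Nᵀ·M·D̂·N` for a BIJECTIVE column re-indexing `e`. -/
theorem coframe_submatrix_mul_basis {ν : Type*} [Fintype ν] (M : Matrix (Site 4 s) (Site 4 s × Fin 4) ℝ) (e : ν ≃ Site 4 s × Fin 4) :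
    (Nᵀ * M).submatrix id e * ((Dhat 4 s).submatrix e id * N) = Nᵀ * M * Dhat 4 s * N := by
  rw [← Matrix.mul_assoc, Matrix.submatrix_mul_equiv, Matrix.submatrix_id_id]

omit [Fintype ρ] [DecidableEq ρ] in
/-- [folklore] **`T₀·Ŵ₀ = X₀`** (`Ŵ₀ = D̂|ₑ·N`, road: `DhatS·N`). -/
theorem Tjet₀_mul_basis {ν : Type*} [Fintype ν] (e : ν ≃ Site 4 s × Fin 4) :
    Tjet₀ s N e * ((Dhat 4 s).submatrix e id * N) = Xjet₀ s N := by
  rw [Tjet₀, Xjet₀, coframe_submatrix_mul_basis]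

omit [Fintype ρ] [DecidableEq ρ] in
/-- [folklore] **`Tₛ·Ŵ₀ = Xₛ`**. -/
theorem Tjet₁_mul_basis {ν : Type*} [Fintype ν] (e : ν ≃ Site 4 s × Fin 4) :
    Tjet₁ s b N e * ((Dhat 4 s).submatrix e id * N) = Xjet₁ s b N := by
  rw [Tjet₁, Xjet₁, coframe_submatrix_mul_basis]

omit [Fintype ρ] [DecidableEq ρ] in
/-- [folklore] **`Tₛₜ·Ŵ₀ = Xₛₜ`**. -/
theorem Tjet₁₁_mul_basis {ν : Type*} [Fintype ν] (e : ν ≃ Site 4 s × Fin 4) :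
    Tjet₁₁ s b b' N e * ((Dhat 4 s).submatrix e id * N) = Xjet₁₁ s b b' N := by
  rw [Tjet₁₁, Xjet₁₁, coframe_submatrix_mul_basis]

omit [Fintype ρ] [DecidableEq ρ] in
/-- [folklore] **`X₀ = G₀`** (`D̂ᵀD̂ = L̂`, `TorusHodgeWeight.Dhat_transpose_mul_Dhat`). -/
theorem Xjet₀_eq_Gjet₀ : Xjet₀ s N = Gjet₀ s N := by
  rw [Xjet₀, Mjet₀, Gjet₀, ← Matrix.mul_assoc Nᵀ, Matrix.mul_assoc (Nᵀ * Lhat s), Dhat_transpose_mul_Dhat]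

omit [Fintype ρ] [DecidableEq ρ] in
/-- [folklore] **`Xₛ = Nᵀ·(Ljet·L̂ − L̂·(ÊₛᵀD̂))·N`** — the (R2) ghost word of NOTE ρ-g6-13b (NOT the Gram jet `Gₛ = Nᵀ(Ljet·L̂ + L̂·Ljet)N`). -/
theorem Xjet₁_eq : Xjet₁ s b N = Nᵀ * (Ljet s b * Lhat s - Lhat s * ((Djet s b)ᵀ * Dhat 4 s)) * N := by
  rw [Xjet₁, Mjet₁, ← Dhat_transpose_mul_Dhat]
  simp only [Matrix.mul_sub, Matrix.sub_mul, Matrix.mul_assoc]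

end Basis

end Summit.QuantumFields.BalabanUV.Beta.D1BFx.TorusWeightJetsProjector

end
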